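import Literature.AlgebraicGeometry.HodgeTheory.DirectImageTransport
import Literature.AlgebraicTopology.SingularHomology.CupProductExteriorH1
import HarnessLib

/-!
# Transport in `Rᵏ π_* ℂ` commutes with an endomorphism of the family over the base

Family `hodge`, layer `Literature/AlgebraicGeometry/HodgeTheory`. Continuation of
`DirectImageTransport` (parallel transport `transportFun` in the espace étalé `FiberClass π k` of
`Rᵏ π_* ℂ` over a cohomologically locally trivial `U ⊆ S(ℂ)`). Let `g : 𝒳 ⟶ 𝒳` be an
endomorphism of the total space OVER THE BASE, `g ≫ π = π` (e.g. the action of `√-d` on an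
abelian scheme, [Deligne1982HodgeCycles, proof of Thm. 4.8, "an action `ν` of `E` on `Y/S`"]).
Then `g` restricts to every fibre, `g_t : 𝒳_t ⟶ 𝒳_t` with `g_t ≫ ι_t = ι_t ≫ g`
(`exists_fiberHom_comp_fiberι`), and:

* `transportFun_map_fiberHom` — **transport commutes with `g`**: `γ_* (g_s^* α) = g_t^* (γ_* α)`
  (the pull-back `g^* : Rᵏ π_* ℂ → Rᵏ π_* ℂ` is a morphism of local systems; Voisin II §3.1.2:
  the local system `Rᵏ π_* A` is functorial in the family), proved from `transportFun_op₂` — `g(ℂ)`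
  preserves every tube `π⁻¹B(ℂ)` and restricts on fibres to `g_t(ℂ)`;
* `transportFun_mem_eigenspace_fiberHom` — hence transport carries the `μ`-eigenspace of `g_s^*`
  on `Hᵏ(X_s)` into the `μ`-eigenspace of `g_t^*` on `Hᵏ(X_t)`;
* `transportFun_cupPowOne` — transport is multiplicative on iterated cup products of degree-one
  classes, `γ_* (v₁ ⌣ ⋯ ⌣ v_d) = γ_* v₁ ⌣ ⋯ ⌣ γ_* v_d` (`transportFun_cupProduct`, and `γ_* 1 = 1`);
* `transportFun_mem_span_cupPowOne_eigenspace` / `transportFun_mem_eigenLines` — consequently the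
  span of the `d`-fold cup products of `μ`-eigenvectors of `g^*` on `H¹` is carried into the
  corresponding span on the target fibre, and so is the sum of two such spans (for an abelian
  scheme with `√-d` acting this is the statement that the WEIL PLANES `⋀^{2k} V₊ ⊕ ⋀^{2k} V₋` of
  the fibres form a sub-local system of `R^{2k} π_* ℂ`, [Deligne1982HodgeCycles, p. 50];
  [vanGeemen1994HodgeAV, 5.8–5.11]).

Everything is real topology on the tree's carriers; no definition and no named fact is introduced.

## References

* [VoisinHodgeII2003] C. Voisin, Hodge Theory and Complex Algebraic Geometry II, CUP 2003, §3.1.2.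
* [Deligne1982HodgeCycles] P. Deligne (notes by J. S. Milne), Hodge cycles on abelian varieties,
  LNM 900 (1982), proof of Thm. 4.8, pp. 48–50.
* [vanGeemen1994HodgeAV] B. van Geemen, An introduction to the Hodge conjecture for abelian
  varieties, LNM 1594 (1994), 5.8–5.11.
-/

noncomputable section

open CategoryTheory AlgebraicGeometry Limits
open _root_.Topology _root_.Filter
open Literature.AlgebraicTopology.SingularHomology

namespace Literature.AlgebraicGeometry.HodgeTheory

section HodgeTheory

variable {𝒳 S : Motives.SchemeOver ℂ} (π : 𝒳 ⟶ S) (k : ℕ) {U : Set (Motives.ComplexPoints S)}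

/-! ### Fibre maps of an endomorphism over the base -/

/-- **An endomorphism over the base restricts to the fibres**: if `g ≫ π = π` then for every
point `t` there is `g_t : 𝒳_t ⟶ 𝒳_t` with `g_t ≫ ι_t = ι_t ≫ g` (universal property of the
fibre product `𝒳_t = 𝒳 ×_S Spec ℂ`; Hartshorne II.3). [folklore] -/
theorem exists_fiberHom_comp_fiberι (g : 𝒳 ⟶ 𝒳) (hg : g ≫ π = π) (t : Motives.ComplexPoints S) :
    ∃ gt : Motives.fiberOver π t ⟶ Motives.fiberOver π t,
      gt ≫ Motives.fiberι π t = Motives.fiberι π t ≫ g := by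
  have hcond : (pullback.fst π.left t.left ≫ g.left) ≫ π.left = pullback.snd π.left t.left ≫ t.left := by
    rw [Category.assoc, ← Over.comp_left, hg, pullback.condition]
  refine ⟨Over.homMk (pullback.lift (pullback.fst π.left t.left ≫ g.left) (pullback.snd π.left t.left) hcond)
    ?_, ?_⟩
  · change pullback.lift _ _ hcond ≫ pullback.fst π.left t.left ≫ 𝒳.hom = pullback.fst π.left t.left ≫ 𝒳.hom
    rw [pullback.lift_fst_assoc, Category.assoc, Over.w g]
  · ext : 1
    change pullback.lift _ _ hcond ≫ pullback.fst π.left t.left = pullback.fst π.left t.left ≫ g.left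
    rw [pullback.lift_fst]

/-- The fibre map is unique: `ι_t` is a monomorphism (base change of the section `t : Spec ℂ → S`).
[folklore] -/
theorem fiberHom_unique (g : 𝒳 ⟶ 𝒳) {t : Motives.ComplexPoints S}
    {gt gt' : Motives.fiberOver π t ⟶ Motives.fiberOver π t}
    (h : gt ≫ Motives.fiberι π t = Motives.fiberι π t ≫ g)
    (h' : gt' ≫ Motives.fiberι π t = Motives.fiberι π t ≫ g) : gt = gt' := by
  have hid : (Motives.specOver ℂ ℂ).hom = 𝟙 (Spec (.of ℂ)) := by
    simp only [Motives.specOver, Over.mk_hom, Algebra.algebraMap_self, CommRingCat.ofHom_id,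
      Spec.map_id]
  have hsec : t.left ≫ S.hom = 𝟙 _ := by rw [Over.w t, hid]; rfl
  haveI : IsSplitMono t.left := IsSplitMono.mk' ⟨S.hom, hsec⟩
  haveI : Mono (Motives.fiberι π t).left := by
    change Mono (pullback.fst π.left t.left)
    infer_instance
  haveI : Mono (Motives.fiberι π t) := Over.mono_of_mono_left _
  exact (cancel_mono (Motives.fiberι π t)).1 (h.trans h'.symm)

/-! ### Transport commutes with the endomorphism -/

section Transport

variable (hU : IsCohomologicallyLocallyTrivialOn π U)

/-- **Transport commutes with an endomorphism over the base.** For `g ≫ π = π` with fibre maps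
`g_t ≫ ι_t = ι_t ≫ g`, and a homotopy class of paths `γ` from `s` to `t` in `U`:
`γ_* (g_s^* α) = g_t^* (γ_* α)` — `g(ℂ)` maps every tube `π⁻¹B(ℂ)` to itself and restricts on
`X_t(ℂ)` to `g_t(ℂ)`, so `g^*` is a fibrewise operation induced from tube classes
(`transportFun_op₂`). [cite: VoisinHodgeII2003, §3.1.2] -/
theorem transportFun_map_fiberHom (g : 𝒳 ⟶ 𝒳) (hg : g ≫ π = π)
    (gf : ∀ t : Motives.ComplexPoints S, Motives.fiberOver π t ⟶ Motives.fiberOver π t)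
    (hgf : ∀ t, gf t ≫ Motives.fiberι π t = Motives.fiberι π t ≫ g)
    {s t : U} (γ : Path.Homotopic.Quotient s t) (α : complexBetti (Motives.fiberOver π s.1) k) :
    transportFun π k hU γ (complexBetti.map (gf s.1) k α) =
      complexBetti.map (gf t.1) k (transportFun π k hU γ α) := by
  have hmem : ∀ (B : Set (Motives.ComplexPoints S)) (P : tubeOver π B),
      Motives.AlgPoints.map g P.1 ∈ tubeOver π B := fun B P ↦ by
    rw [mem_tubeOver_iff, ← Motives.AlgPoints.map_comp_apply, hg]
    exact P.2
  let G : ∀ B : Set (Motives.ComplexPoints S), C(tubeOver π B, tubeOver π B) := fun B ↦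
    ⟨fun P ↦ ⟨Motives.AlgPoints.map g P.1, hmem B P⟩,
      ((Motives.AlgPoints.continuous_map g).comp continuous_subtype_val).subtype_mk _⟩
  have hcomp : ∀ (B : Set (Motives.ComplexPoints S)) (t : Motives.ComplexPoints S) (ht : t ∈ B),
      (fiberToTube π ht).comp (Motives.AlgPoints.mapContinuous (L := ℂ) (gf t)) =
        (G B).comp (fiberToTube π ht) := fun B t ht ↦ by
    ext P : 2
    change Motives.AlgPoints.map (Motives.fiberι π t) (Motives.AlgPoints.map (gf t) P) =
      Motives.AlgPoints.map g (Motives.AlgPoints.map (Motives.fiberι π t) P)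
    rw [← Motives.AlgPoints.map_comp_apply, ← Motives.AlgPoints.map_comp_apply, hgf]
  exact transportFun_op₂ π hU (k₂ := k)
    (fun t a _ ↦ complexBetti.map (gf t) k a)
    (fun B ξ _ ↦ singularCohomology.map ℂ ℂ (G B) k ξ)
    (fun B t ht ξ _ ↦ by
      change singularCohomology.map ℂ ℂ (Motives.AlgPoints.mapContinuous (L := ℂ) (gf t)) k
          (singularCohomology.map ℂ ℂ (fiberToTube π ht) k ξ) =
        singularCohomology.map ℂ ℂ (fiberToTube π ht) k (singularCohomology.map ℂ ℂ (G B) k ξ)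
      rw [← ModuleCat.comp_apply, ← singularCohomology.map_comp, hcomp, singularCohomology.map_comp,
        ModuleCat.comp_apply])
    γ α α

/-- **Transport preserves the eigenspaces of `g^*`**: if `g_s^* v = μ v` then
`g_t^* (γ_* v) = μ γ_* v`. [cite: VoisinHodgeII2003, §3.1.2] -/
theorem transportFun_mem_eigenspace_fiberHom (g : 𝒳 ⟶ 𝒳) (hg : g ≫ π = π)
    (gf : ∀ t : Motives.ComplexPoints S, Motives.fiberOver π t ⟶ Motives.fiberOver π t)
    (hgf : ∀ t, gf t ≫ Motives.fiberι π t = Motives.fiberι π t ≫ g)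
    {s t : U} (γ : Path.Homotopic.Quotient s t) {μ : ℂ} {v : complexBetti (Motives.fiberOver π s.1) k}
    (hv : v ∈ Module.End.eigenspace (complexBetti.map (gf s.1) k).hom μ) :
    transportFun π k hU γ v ∈ Module.End.eigenspace (complexBetti.map (gf t.1) k).hom μ := by
  rw [Module.End.mem_eigenspace_iff] at hv ⊢
  change complexBetti.map (gf t.1) k (transportFun π k hU γ v) = _
  rw [← transportFun_map_fiberHom π k hU g hg gf hgf γ v]
  change transportFun π k hU γ ((complexBetti.map (gf s.1) k).hom v) = _
  rw [hv, transportFun_smul]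

/-- **Transport is multiplicative on iterated cup products of degree-one classes**:
`γ_* (v₁ ⌣ ⋯ ⌣ v_d) = γ_* v₁ ⌣ ⋯ ⌣ γ_* v_d` (`transportFun_cupProduct` and `γ_* 1 = 1`, the unit
being the restriction of the global unit). [cite: VoisinHodgeII2003, §3.1.2] -/
theorem transportFun_cupPowOne {s t : U} (γ : Path.Homotopic.Quotient s t) (d : ℕ)
    (w : Fin d → complexBetti (Motives.fiberOver π s.1) 1) :
    transportFun π d hU γ (cupPowOne ℂ (Motives.ComplexPoints (Motives.fiberOver π s.1)) d w) =
      cupPowOne ℂ (Motives.ComplexPoints (Motives.fiberOver π t.1)) d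
        (fun i ↦ transportFun π 1 hU γ (w i)) := by
  induction d with
  | zero =>
    rw [cupPowOne_zero, cupPowOne_zero,
      ← singularCohomology.map_one (R := ℂ) (Motives.AlgPoints.mapContinuous (L := ℂ) (Motives.fiberι π s.1)),
      ← singularCohomology.map_one (R := ℂ) (Motives.AlgPoints.mapContinuous (L := ℂ) (Motives.fiberι π t.1))]
    exact transportFun_map_fiberι π 0 hU γ (singularCohomology.one ℂ (Motives.ComplexPoints 𝒳))
  | succ d ih =>
    rw [cupPowOne_succ, cupPowOne_succ, transportFun_cupProduct, ih]
    rfl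

/-- **Transport carries the span of the `d`-fold cup products of `μ`-eigenvectors of `g_s^*` on
`H¹(X_s)` into the corresponding span on `X_t`** (for an abelian scheme with `√-d` acting: the Weil
line `⋀^{2k} V_μ` is a sub-local system). [cite: Deligne1982HodgeCycles, proof of Thm. 4.8, p. 50] -/
theorem transportFun_mem_span_cupPowOne_eigenspace (g : 𝒳 ⟶ 𝒳) (hg : g ≫ π = π)
    (gf : ∀ t : Motives.ComplexPoints S, Motives.fiberOver π t ⟶ Motives.fiberOver π t)
    (hgf : ∀ t, gf t ≫ Motives.fiberι π t = Motives.fiberι π t ≫ g)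
    {s t : U} (γ : Path.Homotopic.Quotient s t) (μ : ℂ) (d : ℕ)
    {α : complexBetti (Motives.fiberOver π s.1) d}
    (hα : α ∈ Submodule.span ℂ
      {x | ∃ w : Fin d → complexBetti (Motives.fiberOver π s.1) 1,
        (∀ i, w i ∈ Module.End.eigenspace (complexBetti.map (gf s.1) 1).hom μ) ∧
        cupPowOne ℂ (Motives.ComplexPoints (Motives.fiberOver π s.1)) d w = x}) :
    transportFun π d hU γ α ∈ Submodule.span ℂ
      {x | ∃ w : Fin d → complexBetti (Motives.fiberOver π t.1) 1,
        (∀ i, w i ∈ Module.End.eigenspace (complexBetti.map (gf t.1) 1).hom μ) ∧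
        cupPowOne ℂ (Motives.ComplexPoints (Motives.fiberOver π t.1)) d w = x} := by
  induction hα using Submodule.span_induction with
  | mem x hx =>
    obtain ⟨w, hw, rfl⟩ := hx
    refine Submodule.subset_span ⟨fun i ↦ transportFun π 1 hU γ (w i), fun i ↦ ?_, ?_⟩
    · exact transportFun_mem_eigenspace_fiberHom π 1 hU g hg gf hgf γ (hw i)
    · rw [transportFun_cupPowOne]
  | zero =>
    rw [show (0 : complexBetti (Motives.fiberOver π s.1) d) = (0 : ℂ) • 0 from (zero_smul ℂ _).symm,
      transportFun_smul, zero_smul]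
    exact Submodule.zero_mem _
  | add x y _ _ hx hy =>
    rw [transportFun_add]
    exact Submodule.add_mem _ hx hy
  | smul c x _ hx =>
    rw [transportFun_smul]
    exact Submodule.smul_mem _ c hx

/-- **The sum of two eigen-lines is a sub-local system**: transport carries
`Span(m_d V_μ) ⊔ Span(m_d V_ν)` at `s` into the same at `t` (for an abelian scheme with `√-d`:
the Weil plane `⋀^{2k} V₊ ⊕ ⋀^{2k} V₋` is flat; "`Γ ⊂ SU`", the determinant question being a
separate matter). [cite: Deligne1982HodgeCycles, proof of Thm. 4.8, p. 50]
[cite: vanGeemen1994HodgeAV, 5.8–5.11] -/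
theorem transportFun_mem_eigenLines (g : 𝒳 ⟶ 𝒳) (hg : g ≫ π = π)
    (gf : ∀ t : Motives.ComplexPoints S, Motives.fiberOver π t ⟶ Motives.fiberOver π t)
    (hgf : ∀ t, gf t ≫ Motives.fiberι π t = Motives.fiberι π t ≫ g)
    {s t : U} (γ : Path.Homotopic.Quotient s t) (μ ν : ℂ) (d : ℕ)
    {α : complexBetti (Motives.fiberOver π s.1) d}
    (hα : α ∈ Submodule.span ℂ
        {x | ∃ w : Fin d → complexBetti (Motives.fiberOver π s.1) 1,
          (∀ i, w i ∈ Module.End.eigenspace (complexBetti.map (gf s.1) 1).hom μ) ∧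
          cupPowOne ℂ (Motives.ComplexPoints (Motives.fiberOver π s.1)) d w = x} ⊔
      Submodule.span ℂ
        {x | ∃ w : Fin d → complexBetti (Motives.fiberOver π s.1) 1,
          (∀ i, w i ∈ Module.End.eigenspace (complexBetti.map (gf s.1) 1).hom ν) ∧
          cupPowOne ℂ (Motives.ComplexPoints (Motives.fiberOver π s.1)) d w = x}) :
    transportFun π d hU γ α ∈ Submodule.span ℂ
        {x | ∃ w : Fin d → complexBetti (Motives.fiberOver π t.1) 1,
          (∀ i, w i ∈ Module.End.eigenspace (complexBetti.map (gf t.1) 1).hom μ) ∧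
          cupPowOne ℂ (Motives.ComplexPoints (Motives.fiberOver π t.1)) d w = x} ⊔
      Submodule.span ℂ
        {x | ∃ w : Fin d → complexBetti (Motives.fiberOver π t.1) 1,
          (∀ i, w i ∈ Module.End.eigenspace (complexBetti.map (gf t.1) 1).hom ν) ∧
          cupPowOne ℂ (Motives.ComplexPoints (Motives.fiberOver π t.1)) d w = x} := by
  obtain ⟨a, ha, b, hb, rfl⟩ := Submodule.mem_sup.1 hα
  rw [transportFun_add]
  exact Submodule.add_mem_sup
    (transportFun_mem_span_cupPowOne_eigenspace π hU g hg gf hgf γ μ d ha)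
    (transportFun_mem_span_cupPowOne_eigenspace π hU g hg gf hgf γ ν d hb)

end Transport

end HodgeTheory

end Literature.AlgebraicGeometry.HodgeTheory

end
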